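import Summits.ValiantsHypothesis.ValiantsHypothesis.Theses.ProofCarryingSymmetry
import Summits.ValiantsHypothesis.ValiantsHypothesis.Theorems.HubHub
import Literature.Computability.AlgebraicComplexity.ValiantConjectureProofs

/-!
# ValiantsHypothesis / ProofCarryingSymmetry — assembly

Settles item stmt-ValiantsHypothesis-10345 (rank-1 assembly of route ProofCarryingSymmetry):
`SquareSymmetricPermLB → RestorationQP → ValiantsHypothesis`.

Bookkeeping. Suppose `VP_ℂ = VNP_ℂ`; then the permanent family is a `VP` family
(`perFamily_mem_VNP_holds`, renaming bridge `mem_VP_ofFintype_iff_holds`, packaged in the hub lemma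
`Summit.ValiantsHypothesis.Hub.valiantsHypothesis_of_not_isVPFamily_per`). The permanent `per_n` is
invariant under the diagonal relabelling `x_ij ↦ x_{σ i, σ j}` (`rename_smul_perPoly`: reindex the
permutation sum by conjugation), so `RestorationQP` yields, for some `c` and every `n`, an `S_n`-symmetric
labelled circuit computing `per_n` of size `≤ 2^{(log₂ n + c)^c}`; choice turns `∀ n, ∃ G …` into a
family, and `SquareSymmetricPermLB` (Dawar–Wilsenach) gives `ε > 0` with `2^{ε n} ≤ size` for
arbitrarily large `n`. But `(log₂ n + c)^c < ε n` for all large `n`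
(`natLog_add_pow_lt_mul_eventually`, from Mathlib's `tendsto_pow_const_div_const_pow_of_one_lt`:
`m^c / 2^m → 0`, applied at `m = log₂ n + c` with `2^{log₂ n} ≤ n`) — contradiction.
-/

namespace Summit.ValiantsHypothesis.Theorems.ProofCarryingSymmetry

open Literature.Computability.AlgebraicComplexity

/-- The generic permanent `per_n` is invariant under the diagonal relabelling of the variable
matrix, `x_ij ↦ x_{σ i, σ j}`: reindex the permutation sum `∑_π ∏_i x_{π i, i}` by conjugation
`π ↦ σ π σ⁻¹` (`Equiv.permCongr`) and the product by `σ`. [folklore] -/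
theorem rename_smul_perPoly (n : ℕ) (σ : Equiv.Perm (Fin n)) :
    MvPolynomial.rename (fun x : Fin n × Fin n => σ • x) (perPoly (Fin n) ℂ) = perPoly (Fin n) ℂ := by
  simp only [perPoly, Matrix.permanent, map_sum, map_prod, Matrix.mvPolynomialX_apply,
    MvPolynomial.rename_X]
  refine Fintype.sum_equiv (Equiv.permCongr σ) _ _ fun π => ?_
  refine Fintype.prod_equiv σ _ _ fun i => ?_
  simp

/-- Quasi-polynomial is `2^{o(n)}`, exponent form: for every `c : ℕ` and `ε > 0`,
`(log₂ n + c)^c < ε n` for all large `n` (with `log₂ = Nat.log 2`). From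
`m^c / 2^m → 0` (`tendsto_pow_const_div_const_pow_of_one_lt`) at `m = log₂ n + c`, using
`2^{log₂ n} ≤ n`. [folklore] -/
theorem natLog_add_pow_lt_mul_eventually (c : ℕ) {ε : ℝ} (hε : 0 < ε) :
    ∃ n₀ : ℕ, ∀ n ≥ n₀, (((Nat.log 2 n + c) ^ c : ℕ) : ℝ) < ε * n := by
  have ht := tendsto_pow_const_div_const_pow_of_one_lt c (one_lt_two (α := ℝ))
  have hδ : (0 : ℝ) < ε / 2 ^ c := div_pos hε (pow_pos two_pos c)
  obtain ⟨N, hN⟩ := Filter.eventually_atTop.1 (ht.eventually (gt_mem_nhds hδ))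
  refine ⟨2 ^ N, fun n hn => ?_⟩
  have hn0 : n ≠ 0 := by
    have : 0 < 2 ^ N := pow_pos two_pos N
    omega
  set m := Nat.log 2 n with hm
  have hNm : N ≤ m := Nat.le_log_of_pow_le one_lt_two hn
  have hmn : 2 ^ m ≤ n := Nat.pow_log_le_self 2 hn0
  have h1 := hN (m + c) (hNm.trans (Nat.le_add_right m c))
  -- h1 : ((m + c : ℕ) : ℝ) ^ c / 2 ^ (m + c) < ε / 2 ^ c
  have h2pos : (0 : ℝ) < 2 ^ (m + c) := pow_pos two_pos _
  rw [div_lt_iff₀ h2pos] at h1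
  have h2 : ε / 2 ^ c * 2 ^ (m + c) = ε * (2 : ℝ) ^ m := by
    rw [pow_add]
    field_simp
  rw [h2] at h1
  have h3 : ε * (2 : ℝ) ^ m ≤ ε * n := by
    refine mul_le_mul_of_nonneg_left ?_ hε.le
    exact_mod_cast hmn
  calc (((m + c) ^ c : ℕ) : ℝ) = ((m + c : ℕ) : ℝ) ^ c := by push_cast; ring
    _ < ε * (2 : ℝ) ^ m := h1
    _ ≤ ε * n := h3

/-- Settles stmt-ValiantsHypothesis-10345 (assembly of route ProofCarryingSymmetry):
`SquareSymmetricPermLB → RestorationQP → ValiantsHypothesis`. Proof: were `VP ℂ = VNP ℂ`, the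
permanent would be a `VP` family (hub lemma `valiantsHypothesis_of_not_isVPFamily_per` with
`mem_VP_ofFintype_iff_holds` and `perFamily_mem_VNP_holds`); `per_n` being diagonally
`S_n`-invariant (`rename_smul_perPoly`), `RestorationQP` gives `S_n`-symmetric circuits for `per_n`
of size `≤ 2^{(log₂ n + c)^c}` for every `n`, while `SquareSymmetricPermLB` gives `ε > 0` and
arbitrarily large `n` with `2^{ε n} ≤` size; comparing exponents (`Real.rpow_le_rpow_left_iff`)
contradicts `(log₂ n + c)^c < ε n` eventually (`natLog_add_pow_lt_mul_eventually`). [folklore] -/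
theorem Assembly_proof :
    Summit.ValiantsHypothesis.ValiantsHypothesis.Theses.ProofCarryingSymmetry.Assembly := by
  unfold Summit.ValiantsHypothesis.ValiantsHypothesis.Theses.ProofCarryingSymmetry.Assembly
  intro hLB hR
  refine Summit.ValiantsHypothesis.Hub.valiantsHypothesis_of_not_isVPFamily_per ?_
    (mem_VP_ofFintype_iff_holds _) (perFamily_mem_VNP_holds ℂ)
  intro hVP
  obtain ⟨c, hc⟩ := hR (fun n => perPoly (Fin n) ℂ) (fun n σ => rename_smul_perPoly n σ) hVP
  choose G hG C hsym heval hcard using hc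
  obtain ⟨ε, hε, hio⟩ := @hLB G hG C hsym heval
  obtain ⟨n₀, hn₀⟩ := natLog_add_pow_lt_mul_eventually c hε
  obtain ⟨n, hn, hle⟩ := hio n₀
  have h1 : (Fintype.card (G n) : ℝ) ≤ (2 : ℝ) ^ (((Nat.log 2 n + c) ^ c : ℕ) : ℝ) := by
    rw [Real.rpow_natCast]
    exact_mod_cast hcard n
  have h2 : ε * n ≤ (((Nat.log 2 n + c) ^ c : ℕ) : ℝ) :=
    (Real.rpow_le_rpow_left_iff one_lt_two).1 (hle.trans h1)
  exact absurd (hn₀ n hn) (not_lt.2 h2)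

end Summit.ValiantsHypothesis.Theorems.ProofCarryingSymmetry
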